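import Summits.BirchSwinnertonDyer.Rank1Residual.Additive.GordRankOneKatoCertificateThree
import Summits.BirchSwinnertonDyer.Rank1Residual.Additive.X4RankOneKimResidue
import Summits.BirchSwinnertonDyer.Rank1Residual.Additive.TypeGThreeTowerOfSurj
import HarnessLib

/-!
# X4♯(G-ord)@3 ∧ `r_an = 1`: the two rank-one currencies AGREE — a `Ш`-free, BSD-free identity between
# the first Kurihara invariant `∂^{(1)}(δ̃)` and the 3-adic regulator valuation on T-O7K3's certificate rows
# (cell `b2b-bsdres`, team n1011, seat p17 gen 2 — support lemma for rows T-O7K3 (p12) / T-a2r1c (p17);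
# CROSS-INSTRUMENT CONSISTENCY for the census: KURX `∂^{(1)}` vs the height lane's `v(Reg₃)`)

HONEST FRAMING (cell `b2b-bsdres`, run/shared/lean/b2b/bsd-rank1-residual/, verbatim in every
file): the goal of the cell is to DELETE the COMBINATION-SHAPED residual classes of the
Birch–Swinnerton-Dyer formula for ALL analytic-rank `≤ 1` elliptic curves over `ℚ` — "full BSD
formula for every rank `≤ 1` curve in class `C`" assembled STRICTLY from published theorems — so
that the rank-`≤ 1` remainder becomes exactly the CONSTRUCTION-SHAPED classes, which are TYPED
(missing-input `Prop`s), NOT attempted. This is not "finishing BSD". Team n1011: prove what is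
provable now; shrink each hard class to its core with data; no claim beyond stated classes;
research routes; census output = EVIDENCE / conjecture items, never a Literature fact; RESIDUAL-MAP
marks change only by signed lines. X4 stays CONSTRUCTION-SHAPED; §I O7 / N10 stay as marked; nothing
here is booked. Theorems only (NO definition, NO Literature fact, NO `_holds`); every published input,
every conjecture and every certificate is an explicit hypothesis; `#print axioms` standard.

COVERAGE (stated first, referee 1 proviso): per pair, `p = 3`, `W/ℚ` globally minimal, `ClassX4Gord W 3`
(additive, `E[3]` irreducible, potentially good ORDINARY of type (G)), semistability defect `e = 2`,
`ρ̄_{E,3}` onto, analytic rank `1`. HYPOTHESES (the UNION of T-O7K3's and T-a2r1c's, all explicit):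
Kato's half-eigenspace divisibility `hKato` (= `Wuthrich2014.kato_halfEigenCharIdeal_dvd_cyclotomicPrime_of_surjective`,
PUBLISHED, Kato Thm. 17.4 (3)), the branch-unit certificate `BranchUnitCertificateAt W 3` (per pair,
EVIDENCE), a (B)-datum `Dh` (`LeadingTermClauses W 3 Dh`; supplied by `Delbourgo2002.mainTheorem_three`
for non-CM `E` in the `exists_` form), a cyclotomic Selmer dual datum with principal characteristic
ideal; AND our conjecture `X4SharpThreeKimRankOnePartial` (`h3`), Kim's Conjecture 1.10 at the pair
(`hT : X4.KimTamagawaDefectAt W 3 D.f`, BOTH halves, p12's typed `Prop`), a modular parametrisation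
datum `D` with `3 ∤ c_D` and the period transfer, and `∂^{(1)}(δ̃) ≠ ∞` (ONE non-zero cyclic
prime-level Kurihara number). The 3-adic tower is p14's THEOREM on (G) rows (no certificate).

## What and why

On these rows p12's T-O7K3 identity (p253254 `ClassX4Gord.padicVal_identity_three_rankOne_of_katoHalf_of_cert`)
reads `ord₃ #Ш(E)(3) + v(Reg₃(E,Dh)) + ord₃ ∏_ℓ c_ℓ + ord₃ ℓ₃ = 1 + 2·ord₃ #E(ℚ)_tors` (`ℓ₃ ∣ 9`,
`ℓ₃ = 1` off the anomalous rows), and p17's T-a2r1c identity (p253784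
`padicValNat_shaOrder_add_partialInfty_eq_of_kimRankOnePartialAt` + `hT`) reads
`∂^{(1)}(δ̃) = ord₃ #Ш(E) + ord₃ ∏_ℓ c_ℓ`. ELIMINATING `Ш` (and `∏c`):

  **`∂^{(1)}(δ̃) + v(Reg₃(E,Dh)) + ord₃ ℓ₃ = 1 + 2·ord₃ #E(ℚ)_tors = 1`** (`3 ∤ #tors` since `E[3]` is
  irreducible) — `kuriharaPartial_one_identity_three_of_kimPartial_of_tamagawaDefect_of_katoHalf_of_cert`;
  off the anomalous rows **`∂^{(1)}(δ̃) + v(Reg₃) = 1`** (`…_of_nonAnomalous`).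

Neither `#Ш` nor `#Ш_an` nor BSD appears: the identity compares two INSTRUMENTS — the first Kurihara
invariant (modular symbols, KURX / I-12@3) and the 3-adic regulator valuation (p-adic heights, the
census height lane) — so on every Gord3 ∩ surj ∩ `r = 1` row carrying a branch-unit certificate it is a
FALSIFICATION TEST of {`X4SharpThreeKimRankOnePartial`, Conj. 1.10 at the pair} AGAINST {Kato 17.4 (3),
Delbourgo 2002 (B)} (EVIDENCE; anomaly protocol: a violating pair refutes the conjectural side or a
certificate, never BSD). Universe: Gord3 ∩ X4@3 ∧ r1 = 576 rows (541 surj; non-anomalous 337 — p17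
split of record), restricted to T-O7K3's certificate-carrying rows.

References: C.-H. Kim, Amer. J. Math. 148 (2026) [Kim2022StructureSelmer] Thm. 1.9 (6), Conj. 1.10
(PDF p. 8); K. Kato, Astérisque 295 (2004) [Kato2004Asterisque] Thm. 17.4 (3) (p. 273); C. Wuthrich,
Doc. Math. 19 (2014) [Wuthrich2014]; D. Delbourgo, JNT 95 (2002) [Delbourgo2002] Thm. (A), (B) (p. 40);
cell files cells/n1011/OWNERS.md (T-O7K3, T-a2r1c), cells/n1011/skel/T-O7K3.md, HOME/INBOX.md
2026-08-21 07:2xZ (p17 offer).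
-/

noncomputable section

open scoped Classical MatrixGroups ModularForm NumberField

namespace Summit.BirchSwinnertonDyer.Rank1Residual.Additive

open CongruenceSubgroup WeierstrassCurve NumberField Literature.NumberTheory.EllipticCurves
  Literature.NumberTheory.EllipticCurves.ModularForms
  Literature.NumberTheory.EllipticCurves.Rank1Residual
  Literature.NumberTheory.EllipticCurves.Rank1Residual.Typed
  Literature.NumberTheory.EllipticCurves.Delbourgo2002
  Literature.NumberTheory.GaloisRepresentations Summit.BirchSwinnertonDyer.Rank1Residual.AdditivePotMult
  Summit.BirchSwinnertonDyer.Rank1Residual.X1.MuLambda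
  Summit.BirchSwinnertonDyer.Rank1Residual.X1.RankOneParitySqueeze
  IsDedekindDomain

variable {W : WeierstrassCurve ℚ} [W.IsElliptic] [W.IsGloballyMinimal] [hp : Fact (Nat.Prime 3)]

/-- **The two rank-one currencies agree (given (B)-datum)**: on X4♯(G-ord)@3 ∧ `e = 2` ∧ surj(3) ∧
`r_an = 1`, granted Kato 17.4 (3) (`hKato`), the branch-unit certificate, the (B)-clauses for `Dh`, a
cyclotomic dual datum with `char = (fE)` — AND our `∂`-clause conjecture `h3`, Kim's Conjecture 1.10 at
the pair `hT`, the modular datum with `3 ∤ c_D` + period transfer, `∂^{(1)}(δ̃) ≠ ∞`: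
`∂^{(1)}(δ̃) = m` with **`m + v(Reg₃(E,Dh)) + ord₃ ℓ₃ = 1 + 2·ord₃ #E(ℚ)_tors`**, `ℓ₃ ∣ 9`, `ℓ₃ = 1` off
the anomalous rows. `Ш`-free, BSD-free. Per pair; nothing booked.
[cite: Kim2022StructureSelmer, Thm. 1.9 (6), Conj. 1.10 (PDF p. 8)] [cite: Kato2004Asterisque, Thm. 17.4 (3) (p. 273)]
[cite: Delbourgo2002, Theorem (B) (p. 40)] -/
theorem ClassX4Gord.kuriharaPartial_one_identity_three_of_kimPartial_of_tamagawaDefect_of_katoHalf_of_cert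
    (h3 : X4SharpThreeKimRankOnePartial)
    (hKato : Wuthrich2014.kato_halfEigenCharIdeal_dvd_cyclotomicPrime_of_surjective)
    (hmodD : nonempty_modularParametrizationData)
    (hGZK : rank_eq_analyticRank_of_analyticRank_le_one) (hmod : hasEntireLFunction_rat)
    (hX : ClassX4Gord W 3) (he : semistabilityIndex W 3 = 2) (hsurj : Surj W 3)
    (hcert : BranchUnitCertificateAt W 3) (hr : W.analyticRank = 1)
    {Dh : PAdicHeightData W 3} (hB : LeadingTermClauses W 3 Dh)
    {κ : ZpExtension ℚ 3} {γ : Field.absoluteGaloisGroup ℚ}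
    (hκ : κ.IsCyclotomic) (hγ : κ.IsTopGenerator γ) (hγ' : IsCyclotomicVariable 3 γ)
    (Dsel : W.SelmerDualData κ γ) {fE : IwasawaAlgebra 3} (hchar : Dsel.charIdeal = Ideal.span {fE})
    {N : ℕ} [NeZero N] (D : ModularParametrizationData W N) (hc : ¬ (3 : ℤ) ∣ D.maninConstant)
    (hper : ∃ u : ℚ, ‖(u : ℚ_[3])‖ = 1 ∧ W.realPeriodRat = u * plusPeriod D.f)
    (hne : kuriharaPartial W 3 D.f 1 ≠ ⊤) (hT : X4.KimTamagawaDefectAt W 3 D.f) :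
    ∃ ℓ : ℕ, ℓ ∣ 3 ^ 2 ∧ (ReductionNonAnomalous W 3 → ℓ = 1) ∧
      ∃ m : ℕ, kuriharaPartial W 3 D.f 1 = m ∧
        (m : ℤ) + (padicRegulator Dh).valuation + padicValNat 3 ℓ = 1 + 2 * padicValNat 3 W.torsionOrder := by
  have hr1 : W.analyticRank ≤ 1 := by rw [hr]
  have hL : W.entireLFunction 1 = 0 := by
    by_contra hne'
    have h0 := (W.analyticRank_eq_zero_iff_holds (hmod W)).mpr hne'
    omega
  have hfin : Finite W.sha := (hGZK W hr1).2
  haveI : Finite W.sha := hfin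
  -- the Kurihara side: `ord₃ #Ш + ∂^{(∞)} = ∂^{(1)}` and `∂^{(∞)} = ord₃ ∏c`
  have hid := padicValNat_shaOrder_add_partialInfty_eq_of_kimRankOnePartialAt W 3
    (kimRankOnePartialAt_three_of_classX4 W h3 hX.1) hsurj
    (ClassX4.towerSurj_three_of_surj_of_typeG_or_potMult hX.1 (Or.inl hX.typeGOrd.typeG) hsurj) hL hr hfin
    D (by exact_mod_cast hc) hper hne
  unfold X4.KimTamagawaDefectAt at hT
  rw [hT] at hid
  -- the Kato side (p12)
  obtain ⟨-, -, -, -, ℓ, hℓ, hℓ1, hidK⟩ :=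
    hX.padicVal_identity_three_rankOne_of_katoHalf_of_cert hKato hmodD hGZK he hsurj hcert hr hB hκ hγ hγ'
      Dsel hchar
  rw [padicValNat_card_addPrimaryComponent 3] at hidK
  refine ⟨ℓ, hℓ, hℓ1, padicValNat 3 W.shaOrder + padicValNat 3 W.tamagawaProduct, ?_, ?_⟩
  · rw [← hid]
    push_cast
    rfl
  · unfold WeierstrassCurve.shaOrder
    rw [Nat.cast_add]
    linarith

/-- **The same with `3 ∤ #E(ℚ)_tors` discharged** (`E[3]` irreducible on class X4): `∂^{(1)}(δ̃) = m` with
**`m + v(Reg₃(E,Dh)) + ord₃ ℓ₃ = 1`**; and **off the anomalous rows `m + v(Reg₃(E,Dh)) = 1`** — in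
particular `∂^{(1)}(δ̃) ≤ 1` there whenever `v(Reg₃) ≥ 0`. Per pair; nothing booked.
[cite: Kim2022StructureSelmer, Thm. 1.9 (6), Conj. 1.10 (PDF p. 8)] [cite: Kato2004Asterisque, Thm. 17.4 (3) (p. 273)]
[cite: Delbourgo2002, Theorem (B) (p. 40)] -/
theorem ClassX4Gord.kuriharaPartial_one_add_regulator_eq_one_three_of_nonAnomalous
    (h3 : X4SharpThreeKimRankOnePartial)
    (hKato : Wuthrich2014.kato_halfEigenCharIdeal_dvd_cyclotomicPrime_of_surjective)
    (hmodD : nonempty_modularParametrizationData)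
    (hGZK : rank_eq_analyticRank_of_analyticRank_le_one) (hmod : hasEntireLFunction_rat)
    (hX : ClassX4Gord W 3) (he : semistabilityIndex W 3 = 2) (hsurj : Surj W 3)
    (hcert : BranchUnitCertificateAt W 3) (hr : W.analyticRank = 1) (hna : ReductionNonAnomalous W 3)
    {Dh : PAdicHeightData W 3} (hB : LeadingTermClauses W 3 Dh)
    {κ : ZpExtension ℚ 3} {γ : Field.absoluteGaloisGroup ℚ}
    (hκ : κ.IsCyclotomic) (hγ : κ.IsTopGenerator γ) (hγ' : IsCyclotomicVariable 3 γ)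
    (Dsel : W.SelmerDualData κ γ) {fE : IwasawaAlgebra 3} (hchar : Dsel.charIdeal = Ideal.span {fE})
    {N : ℕ} [NeZero N] (D : ModularParametrizationData W N) (hc : ¬ (3 : ℤ) ∣ D.maninConstant)
    (hper : ∃ u : ℚ, ‖(u : ℚ_[3])‖ = 1 ∧ W.realPeriodRat = u * plusPeriod D.f)
    (hne : kuriharaPartial W 3 D.f 1 ≠ ⊤) (hT : X4.KimTamagawaDefectAt W 3 D.f) :
    ∃ m : ℕ, kuriharaPartial W 3 D.f 1 = m ∧ (m : ℤ) + (padicRegulator Dh).valuation = 1 := by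
  obtain ⟨ℓ, -, hℓ1, m, hm, hid⟩ :=
    hX.kuriharaPartial_one_identity_three_of_kimPartial_of_tamagawaDefect_of_katoHalf_of_cert h3 hKato
      hmodD hGZK hmod he hsurj hcert hr hB hκ hγ hγ' Dsel hchar D hc hper hne hT
  have htors0 : padicValNat 3 W.torsionOrder = 0 :=
    padicValNat_torsionOrder_eq_zero_of_irreducible W 3 hX.1.2.2
  rw [hℓ1 hna, htors0] at hid
  refine ⟨m, hm, ?_⟩
  simpa using hid

/-- **With the (B)-datum SUPPLIED by Delbourgo 2002 at `3`** (`hDel3`, non-CM): there is a height datum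
for which the consistency identity holds. Per pair; nothing booked.
[cite: Delbourgo2002, Theorem (A), (B) (p. 40)] [cite: Kim2022StructureSelmer, Thm. 1.9 (6), Conj. 1.10 (PDF p. 8)]
[cite: Kato2004Asterisque, Thm. 17.4 (3) (p. 273)] -/
theorem ClassX4Gord.exists_kuriharaPartial_one_identity_three_of_kimPartial_of_katoHalf_of_cert
    (h3 : X4SharpThreeKimRankOnePartial)
    (hKato : Wuthrich2014.kato_halfEigenCharIdeal_dvd_cyclotomicPrime_of_surjective)
    (hmodD : nonempty_modularParametrizationData) (hDel3 : Delbourgo2002.mainTheorem_three)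
    (hGZK : rank_eq_analyticRank_of_analyticRank_le_one) (hmod : hasEntireLFunction_rat)
    (hX : ClassX4Gord W 3) (he : semistabilityIndex W 3 = 2) (hsurj : Surj W 3)
    (hcert : BranchUnitCertificateAt W 3) (hcm : ¬ W.HasCM) (hr : W.analyticRank = 1)
    {κ : ZpExtension ℚ 3} {γ : Field.absoluteGaloisGroup ℚ}
    (hκ : κ.IsCyclotomic) (hγ : κ.IsTopGenerator γ) (hγ' : IsCyclotomicVariable 3 γ)
    (Dsel : W.SelmerDualData κ γ) {fE : IwasawaAlgebra 3} (hchar : Dsel.charIdeal = Ideal.span {fE})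
    {N : ℕ} [NeZero N] (D : ModularParametrizationData W N) (hc : ¬ (3 : ℤ) ∣ D.maninConstant)
    (hper : ∃ u : ℚ, ‖(u : ℚ_[3])‖ = 1 ∧ W.realPeriodRat = u * plusPeriod D.f)
    (hne : kuriharaPartial W 3 D.f 1 ≠ ⊤) (hT : X4.KimTamagawaDefectAt W 3 D.f) :
    ∃ Dh : PAdicHeightData W 3, LeadingTermClauses W 3 Dh ∧
      ∃ ℓ : ℕ, ℓ ∣ 3 ^ 2 ∧ (ReductionNonAnomalous W 3 → ℓ = 1) ∧
        ∃ m : ℕ, kuriharaPartial W 3 D.f 1 = m ∧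
          (m : ℤ) + (padicRegulator Dh).valuation + padicValNat 3 ℓ =
            1 + 2 * padicValNat 3 W.torsionOrder := by
  obtain ⟨-, Dh, hB⟩ := TypeGOrd.delbourgo2002_three hDel3 hX.typeGOrd hX.addv.2 hcm
  exact ⟨Dh, hB, hX.kuriharaPartial_one_identity_three_of_kimPartial_of_tamagawaDefect_of_katoHalf_of_cert
    h3 hKato hmodD hGZK hmod he hsurj hcert hr hB hκ hγ hγ' Dsel hchar D hc hper hne hT⟩

end Summit.BirchSwinnertonDyer.Rank1Residual.Additive

end
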